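import Literature.AlgebraicGeometry.Deformation.SmoothSchemeLiftObstructionCriterionGlueDatum
import Literature.AlgebraicGeometry.Morphisms.GlueDataOverBase
import HarnessLib

/-!
# An actual flat deformation is the glued scheme of its transition data, I: the trivialisation charts glue to `Ψ : Glue_A(ψ) ⟶ Y`
# (Hartshorne, *Deformation Theory*, proof of Thm. 10.2 (a), read backwards: «`U'_i ≅ U_i ×_k Spec A'` … glue … to obtain `X'`»)

Layer `Literature/AlgebraicGeometry/Deformation` (THEOREMS only; no definition, no instance, no notation); first of the two
(c2c) files of the F3c DICTIONARY «an actual flat deformation ↦ cocycle-exact gluing data» (cell `hodgecm-mathlib`, F-11 (A3);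
B-p21 lineage).  Imports ★ FILE 2 `…CriterionGlueDatum` (the glue datum `deformationGlueDatum`, its charts, overlaps, chart
ring maps `overlapRingHom`, transition maps) and ★ `Morphisms/GlueDataOverBase` (descent of morphisms from a glued scheme).
It does NOT import c1/c2a/c2b: the statements are on DATA + EQUATIONS, which ★ c2b
`FlatDeformationTransitionData.exists_transition_data` supplies by `obtain`.

SETTING. `k` a field, `A` a `k`-algebra with augmentation `π : A → k`; the closed fibre `X → Spec k` (★ K1 convention
`[∀ W, Algebra k Γ(X, W)]` + `halg`), `Y → Spec A` with the twin convention `[∀ W, Algebra A Γ(Y, W)]` + `halgA`, `i : X ⟶ Y`;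
a principal affine cover `U' j` of `Y` (`U' j ∩ U' l = D(b' j l)`), a downstairs affine cover `U j` with `U j = i⁻¹ U' j` (`hU`;
for the derived cover of c2b `hU := fun _ => rfl`) and `U j ∩ U l = D(b j l)`; chart trivialisations
`e j : A ⊗_k Γ(X, U j) ≃ₐ[A] Γ(Y, U' j)` over the closed fibres (`he : i♯ ∘ e j = (a ⊗ s ↦ π(a) s)`), overlap trivialisations
`ε₁ j l` (restricting `e j`, `hε₁`) and `ε₂ j l` (restricting `e l`, `hε₂`), and transition automorphisms `ψ j l` of
`A ⊗_k Γ(U j ∩ U l)` with `ε₂ ∘ ψ = ε₁` (`hψε`; for c2b's data `ψ = transition ε₁ ε₂ = ε₂⁻¹ ∘ ε₁`), admissible (`hψ`) and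
cocycle-exact (`hcoc`) exactly as in FILE 2.

* §0 `SpecMap_base_eq_of_sub_isNilpotent` (two ring maps congruent modulo nilpotents induce the same map on spectra);
  `fromSpec_comp_hom_eq_SpecMap_algebraMap` (`Spec Γ(W) → W ↪ Y → Spec A` is `Spec` of the `A`-structure, over any base ring).
* §1 THE COMPATIBILITY ON `W j l`: both `W j l ↪ Spec (A ⊗_k Γ(U j)) ≅ U' j ↪ Y` and `t j l ≫ (Spec (A ⊗_k Γ(U l)) ≅ U' l ↪ Y)`
  have the normal form `W.toSpecΓ ≫ Spec (Λ_{jl} ∘ ε₁⁻¹) ≫ (U' j ∩ U' l ↪ Y)` (`ι_comp_trivialisationChart`,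
  `transitionMap_comp_trivialisationChart`), by the two ring identities `restrict_symm_eq_overlapRingHom`
  («`((e j)⁻¹ c)|_W = Λ (ε₁⁻¹ (c|))`») and `overlapRingHom_transition_symm_eq` («`Λ (ψ⁻¹ (Φ_l ((e l)⁻¹ c))) = Λ (ε₁⁻¹ (c|))`»).
* §2 **`existsUnique_gluedToDeformation`** — the unique `Ψ : X'_A(ψ) ⟶ Y` with `ι j ≫ Ψ = Spec (e j)⁻¹ ≫ (U' j ↪ Y)`
  (★ `glueData_existsUnique_desc`); **`gluedToDeformation_comp_hom`** — `Ψ ≫ Y.hom = q` for the structure map `q` of FILE 3.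

The second file `FlatDeformationGluedIso.lean` shows `Ψ` is an isomorphism.
HC_CM is proved only modulo the 7 printed citations until rung 0 closes — nothing here bears on a summit statement.

## References
* [Hartshorne2010] R. Hartshorne, *Deformation Theory*, GTM 257, Springer (2010): Thm. 10.2 (a) and its proof (p. 81).
* [StacksProject] The Stacks Project, Tag 01JA (glueing schemes), Tag 01LH (relative glueing).
* [Hartshorne1977] R. Hartshorne, *Algebraic Geometry*, GTM 52 (1977): II Prop. 2.3 / Ex. 2.4 (morphisms into an affine
  scheme), II Ex. 2.12 (glueing), III §4 p. 218 (the affine cover and its intersections).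
-/

noncomputable section

-- `TopCat.Presheaf`/`TopCat.Sheaf` are not reducible (as in Mathlib's `AlgebraicGeometry/Modules`).
set_option backward.isDefEq.respectTransparency false

open CategoryTheory AlgebraicGeometry Opposite TopologicalSpace Limits
open scoped TensorProduct

universe u

namespace Literature.AlgebraicGeometry.Deformation

open Literature.AlgebraicGeometry.Motives Literature.AlgebraicGeometry.Morphisms SmoothAffineDeformation

/-! ## §0 Two generalities: congruent ring maps on spectra; the structure map of an affine open over `Spec A` -/

section General

/-- Two ring maps that are congruent modulo nilpotents pull back every prime to the same prime.
[cite: Hartshorne2010, Thm. 10.2 (proof), p. 81] -/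
theorem comap_eq_comap_of_sub_isNilpotent {S T : Type u} [CommRing S] [CommRing T] (f g : S →+* T)
    (h : ∀ x, IsNilpotent (f x - g x)) (y : PrimeSpectrum T) : PrimeSpectrum.comap f y = PrimeSpectrum.comap g y := by
  ext x
  rw [PrimeSpectrum.comap_asIdeal, Ideal.mem_comap, PrimeSpectrum.comap_asIdeal, Ideal.mem_comap]
  have hmem : f x - g x ∈ y.asIdeal := nilradical_le_prime y.asIdeal (mem_nilradical.2 (h x))
  constructor
  · intro hf
    have h' := y.asIdeal.sub_mem hf hmem
    rwa [sub_sub_cancel] at h'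
  · intro hg
    have h' := y.asIdeal.add_mem hmem hg
    rwa [sub_add_cancel] at h'

/-- **`Spec` of two ring maps congruent modulo nilpotents have the same underlying continuous map.**
[cite: Hartshorne2010, Thm. 10.2 (proof), p. 81] -/
theorem SpecMap_base_eq_of_sub_isNilpotent {S T : Type u} [CommRing S] [CommRing T] (f g : S →+* T)
    (h : ∀ x, IsNilpotent (f x - g x)) :
    (Spec.map (CommRingCat.ofHom f)).base = (Spec.map (CommRingCat.ofHom g)).base := by
  apply TopCat.ext
  intro y
  rw [Spec.map_apply, Spec.map_apply]
  exact comap_eq_comap_of_sub_isNilpotent f g h y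

variable {A : Type u} [CommRing A] {Y : Over (Spec (CommRingCat.of A))}
  [instΓA : ∀ W : Y.left.Opens, Algebra A Γ(Y.left, W)]
  (halgA : ∀ (W : Y.left.Opens) (a : A), algebraMap A Γ(Y.left, W) a = (constToPresheaf Y).app (op W) a)

include halgA in
/-- The structure map `A → Γ(W)` of an open of the `A`-scheme `Y`, as a morphism: `algebraMap A Γ(W) = ΓSpecIso⁻¹ ≫ Y.hom^*|_W`
(the base ring need not be a field). [cite: Hartshorne1977, II Ex. 2.4 (morphisms to `Spec A` and `A`-structures)] -/
theorem ofHom_algebraMap_eq_appLE (W : Y.left.Opens) :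
    CommRingCat.ofHom (algebraMap A Γ(Y.left, W)) = (Scheme.ΓSpecIso (CommRingCat.of A)).inv ≫ Y.hom.appLE ⊤ W le_top := by
  apply CommRingCat.hom_ext
  refine RingHom.ext fun a => ?_
  exact halgA W a

include halgA in
/-- **`Spec Γ(W) → W ↪ Y → Spec A` is `Spec` of the structure map `A → Γ(W)`** for an affine open `W` of a scheme over
`Spec A` (Mathlib `IsAffineOpen.SpecMap_appLE_fromSpec`). [cite: Hartshorne1977, II Ex. 2.4; II Prop. 2.3] -/
theorem fromSpec_comp_hom_eq_SpecMap_algebraMap {W : Y.left.Opens} (hW : IsAffineOpen W) :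
    hW.fromSpec ≫ Y.hom = Spec.map (CommRingCat.ofHom (algebraMap A Γ(Y.left, W))) := by
  have h1 := IsAffineOpen.SpecMap_appLE_fromSpec Y.hom (isAffineOpen_top _) hW (V := W) (U := ⊤) le_top
  rw [IsAffineOpen.fromSpec_top, Scheme.isoSpec_Spec_inv, ← Spec.map_comp] at h1
  rw [← h1, ofHom_algebraMap_eq_appLE halgA W]

end General

/-! ## §1 The trivialisation charts `Spec (A ⊗_k Γ(U j)) ≅ U' j ↪ Y` are compatible with the transition maps -/

section GluedIso

variable {k : Type u} [Field k] {A : Type u} [CommRing A] [Algebra k A] (π : A →ₐ[k] k)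
  {X : Over (Spec (CommRingCat.of k))} [instΓ : ∀ W : X.left.Opens, Algebra k Γ(X.left, W)]
  (halg : ∀ (W : X.left.Opens) (s : k), algebraMap k Γ(X.left, W) s = (constToPresheaf X).app (op W) s)
  {Y : Over (Spec (CommRingCat.of A))} [instΓA : ∀ W : Y.left.Opens, Algebra A Γ(Y.left, W)]
  (halgA : ∀ (W : Y.left.Opens) (a : A), algebraMap A Γ(Y.left, W) a = (constToPresheaf Y).app (op W) a)
  (i : X.left ⟶ Y.left)
  {ι : Type u} (U' : ι → Y.left.affineOpens)
  (b' : (j l : ι) → Γ(Y.left, (U' j).1)) (hb' : ∀ j l, (U' j).1 ⊓ (U' l).1 = Y.left.basicOpen (b' j l))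
  (U : ι → X.left.affineOpens) (hU : ∀ j, (U j).1 = i ⁻¹ᵁ (U' j).1)
  (b : (j l : ι) → Γ(X.left, (U j).1)) (hb : ∀ j l, (U j).1 ⊓ (U l).1 = X.left.basicOpen (b j l))
  (e : ∀ j, A ⊗[k] Γ(X.left, (U j).1) ≃ₐ[A] Γ(Y.left, (U' j).1))
  (he : ∀ j x, i.appLE (U' j).1 (U j).1 (hU j).le (e j x) = specialFibreHom π _ x)
  (ε₁ ε₂ : ∀ j l, A ⊗[k] Γ(X.left, (U j).1 ⊓ (U l).1) ≃ₐ[A] Γ(Y.left, (U' j).1 ⊓ (U' l).1))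
  (hε₁ : ∀ j l (a : A) (s : Γ(X.left, (U j).1)),
    ε₁ j l (a ⊗ₜ X.left.presheaf.map (homOfLE inf_le_left).op s) =
      Y.left.presheaf.map (homOfLE inf_le_left).op (e j (a ⊗ₜ s)))
  (hε₂ : ∀ j l (a : A) (s : Γ(X.left, (U l).1)),
    ε₂ j l (a ⊗ₜ X.left.presheaf.map (homOfLE inf_le_right).op s) =
      Y.left.presheaf.map (homOfLE inf_le_right).op (e l (a ⊗ₜ s)))
  (ψ : (j l : ι) → A ⊗[k] Γ(X.left, (U j).1 ⊓ (U l).1) ≃ₐ[A] A ⊗[k] Γ(X.left, (U j).1 ⊓ (U l).1))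
  (hψε : ∀ j l x, ε₂ j l (ψ j l x) = ε₁ j l x)
  (𝔫 : Ideal A) (h𝔫 : IsNilpotent 𝔫)
  (hψ : ∀ j l x, ψ j l x - x ∈ 𝔫 • (⊤ : Submodule A (A ⊗[k] Γ(X.left, (U j).1 ⊓ (U l).1))))
  (hcoc : ∀ (j l m : ι)
    (Φjl : A ⊗[k] Γ(X.left, (U j).1 ⊓ (U l).1) →ₐ[A] A ⊗[k] Γ(X.left, (U j).1 ⊓ (U l).1 ⊓ (U m).1))
    (_ : ∀ a s, Φjl (a ⊗ₜ s) = a ⊗ₜ X.left.presheaf.map (homOfLE inf_le_left).op s)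
    (Φlm : A ⊗[k] Γ(X.left, (U l).1 ⊓ (U m).1) →ₐ[A] A ⊗[k] Γ(X.left, (U j).1 ⊓ (U l).1 ⊓ (U m).1))
    (_ : ∀ a s, Φlm (a ⊗ₜ s) = a ⊗ₜ X.left.presheaf.map
      (homOfLE (le_inf (inf_le_left.trans inf_le_right) inf_le_right)).op s)
    (Φjm : A ⊗[k] Γ(X.left, (U j).1 ⊓ (U m).1) →ₐ[A] A ⊗[k] Γ(X.left, (U j).1 ⊓ (U l).1 ⊓ (U m).1))
    (_ : ∀ a s, Φjm (a ⊗ₜ s) = a ⊗ₜ X.left.presheaf.map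
      (homOfLE (le_inf (inf_le_left.trans inf_le_left) inf_le_right)).op s)
    (ρjl ρlm ρjm : A ⊗[k] Γ(X.left, (U j).1 ⊓ (U l).1 ⊓ (U m).1) ≃ₐ[A]
      A ⊗[k] Γ(X.left, (U j).1 ⊓ (U l).1 ⊓ (U m).1)),
    (∀ x, ρjl (Φjl x) = Φjl (ψ j l x)) → (∀ x, ρlm (Φlm x) = Φlm (ψ l m x)) →
    (∀ x, ρjm (Φjm x) = Φjm (ψ j m x)) → ρlm * ρjl = ρjm)

/-! ### §1.1 The restriction `A ⊗_k Γ(U j) → Γ(W j l)` is the chart ring map over `U j` -/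

/-- The plain restriction `x ↦ x|_{W j l}` is a chart ring map over `V = U j` on the overlap `W j l`: on `1 ⊗ c` it is
`(p_j^* c)|_{W j l}`. [cite: Hartshorne2010, Thm. 10.2 (proof), p. 81] -/
theorem restrict_one_tmul_eq_appLE (j l : ι) (c : Γ(X.left, (U j).1)) :
    (chartOverlap A U j l).ι.appTop ((Scheme.ΓSpecIso (CommRingCat.of (A ⊗[k] Γ(X.left, (U j).1)))).inv (1 ⊗ₜ c)) =
      ((chartOverlap A U j l).ι ≫ chartProj A U j).appLE (U j).1 ⊤
        (fun x _ => ((chartOverlap_le A U j l) (Set.mem_univ x)).1) c := by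
  have h := appLE_map_eq_appTop_tmul (U j).2 (chartProj A U j) rfl (O := chartOverlap A U j l) (le_refl (U j).1)
    (fun x _ => ((chartOverlap_le A U j l) (Set.mem_univ x)).1) c
  have e0 : X.left.presheaf.map (homOfLE (le_refl (U j).1)).op c = c := by
    have : (homOfLE (le_refl (U j).1)).op = 𝟙 _ := Subsingleton.elim _ _
    rw [this, CategoryTheory.Functor.map_id]
    rfl
  rw [e0] at h
  exact h.symm


/-- **`Λ_{jl} ∘ Φ_j` is the plain restriction** `A ⊗_k Γ(U j) → Γ(W j l)` for any base change `Φ_j (a ⊗ s) = a ⊗ s|_{U j ∩ U l}`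
(1a `chartRingHom_comp_baseChange`). [cite: Hartshorne2010, Thm. 10.2 (proof), p. 81] -/
theorem overlapRingHom_comp_baseChangeLeft (j l : ι)
    {Φ : A ⊗[k] Γ(X.left, (U j).1) →ₐ[A] A ⊗[k] Γ(X.left, (U j).1 ⊓ (U l).1)}
    (hΦ : ∀ a s, Φ (a ⊗ₜ s) = a ⊗ₜ X.left.presheaf.map (homOfLE inf_le_left).op s) :
    (overlapRingHom halg A U j l).comp Φ.toRingHom =
      (chartOverlap A U j l).ι.appTop.hom.comp
        (Scheme.ΓSpecIso (CommRingCat.of (A ⊗[k] Γ(X.left, (U j).1)))).inv.hom :=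
  chartRingHom_comp_baseChange (chartProj A U j) (inf_le_left : (U j).1 ⊓ (U l).1 ≤ (U j).1)
    (Λ := (chartOverlap A U j l).ι.appTop.hom.comp
      (Scheme.ΓSpecIso (CommRingCat.of (A ⊗[k] Γ(X.left, (U j).1)))).inv.hom)
    (fun _ => rfl) (fun c => restrict_one_tmul_eq_appLE U j l c)
    (overlapRingHom_tmul_one halg A U j l) (overlapRingHom_one_tmul halg A U j l) hΦ

/-! ### §1.2 The two ring identities behind the compatibility on `W j l` -/

include hε₁ in
/-- **Left reading**: for `c ∈ Γ(Y, U' j)`, `((e j)⁻¹ c)|_{W j l} = Λ_{jl} (ε₁⁻¹ (c|_{U'j ∩ U'l}))` (`ε₁` restricts `e j`).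
[cite: Hartshorne2010, Thm. 10.2 (proof), p. 81: «restricting to `U_{ij}`»] -/
theorem restrict_symm_eq_overlapRingHom (j l : ι) (c : Γ(Y.left, (U' j).1)) :
    (chartOverlap A U j l).ι.appTop
        ((Scheme.ΓSpecIso (CommRingCat.of (A ⊗[k] Γ(X.left, (U j).1)))).inv ((e j).symm c)) =
      overlapRingHom halg A U j l ((ε₁ j l).symm (Y.left.presheaf.map (homOfLE inf_le_left).op c)) := by
  obtain ⟨Φ, hΦ⟩ := exists_baseChangeMap (A' := A) halg (U j).1 ((U j).1 ⊓ (U l).1) inf_le_left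
  -- `ε₁ ∘ Φ = res ∘ e j`
  have key : ∀ x, ε₁ j l (Φ x) = Y.left.presheaf.map (homOfLE inf_le_left).op (e j x) := by
    intro x
    induction x using TensorProduct.induction_on with
    | zero => simp only [map_zero]
    | tmul a s => rw [hΦ, hε₁]
    | add x y hx hy => rw [map_add, map_add, hx, hy, map_add, map_add]
  have h1 : (ε₁ j l).symm (Y.left.presheaf.map (homOfLE inf_le_left).op c) = Φ ((e j).symm c) := by
    rw [AlgEquiv.symm_apply_eq, key, AlgEquiv.apply_symm_apply]
  rw [h1]
  exact (RingHom.congr_fun (overlapRingHom_comp_baseChangeLeft halg U j l hΦ) ((e j).symm c)).symm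

include hε₂ hψε in
/-- **Right reading**: for `c ∈ Γ(Y, U' l)`, `Λ_{jl} (ψ_{jl}⁻¹ (Φ_l ((e l)⁻¹ c))) = Λ_{jl} (ε₁⁻¹ (c|_{U'j ∩ U'l}))`
(`ε₂` restricts `e l` and `ε₂ ∘ ψ = ε₁`). [cite: Hartshorne2010, Thm. 10.2 (proof), p. 81: «on `U_{ij}`»] -/
theorem overlapRingHom_transition_symm_eq (j l : ι) (c : Γ(Y.left, (U' l).1)) :
    overlapRingHom halg A U j l ((ψ j l).symm (baseChangeRight halg A U j l ((e l).symm c))) =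
      overlapRingHom halg A U j l ((ε₁ j l).symm (Y.left.presheaf.map (homOfLE inf_le_right).op c)) := by
  have key : ∀ x, ε₂ j l (baseChangeRight halg A U j l x) =
      Y.left.presheaf.map (homOfLE inf_le_right).op (e l x) := by
    intro x
    induction x using TensorProduct.induction_on with
    | zero => simp only [map_zero]
    | tmul a s => rw [baseChangeRight_tmul, hε₂]
    | add x y hx hy => rw [map_add, map_add, hx, hy, map_add, map_add]
  have h2 : ∀ y, ε₁ j l ((ψ j l).symm y) = ε₂ j l y := fun y => by
    rw [← hψε, AlgEquiv.apply_symm_apply]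
  congr 1
  rw [eq_comm, AlgEquiv.symm_apply_eq, h2, key, AlgEquiv.apply_symm_apply]

/-! ### §1.3 Both sides of the compatibility in normal form through `U' j ∩ U' l` -/

omit instΓ instΓA in
include hb' in
/-- `U' j ∩ U' l` is affine (principal in `U' j`). [cite: Hartshorne1977, III §4 p. 218] -/
theorem isAffineOpen_inf_upstairs (j l : ι) : IsAffineOpen ((U' j).1 ⊓ (U' l).1) := by
  rw [hb' j l]
  exact (U' j).2.basicOpen _

include hb' hε₁ in
/-- **Normal form of `W j l ↪ Spec (A ⊗_k Γ(U j)) ≅ U' j ↪ Y`**: it is `W.toSpecΓ ≫ Spec (Λ_{jl} ∘ ε₁⁻¹) ≫ (U'j ∩ U'l ↪ Y)`.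
[cite: Hartshorne2010, Thm. 10.2 (proof), p. 81] [cite: Hartshorne1977, II Prop. 2.3 / Ex. 2.4 (morphisms to `Spec`)] -/
theorem ι_comp_trivialisationChart (j l : ι) :
    (chartOverlap A U j l).ι ≫ Spec.map (CommRingCat.ofHom (e j).symm.toAlgHom.toRingHom) ≫ (U' j).2.fromSpec =
      (chartOverlap A U j l : Scheme.{u}).toSpecΓ ≫ Spec.map (CommRingCat.ofHom
        ((overlapRingHom halg A U j l).comp (ε₁ j l).symm.toAlgHom.toRingHom)) ≫
          (isAffineOpen_inf_upstairs U' b' hb' j l).fromSpec := by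
  rw [← (U' j).2.map_fromSpec (isAffineOpen_inf_upstairs U' b' hb' j l) (homOfLE inf_le_left).op,
    ← Spec.map_comp_assoc]
  conv_lhs => rw [eq_toSpecΓ_SpecMap (chartOverlap A U j l).ι]
  rw [Category.assoc, ← Spec.map_comp_assoc]
  congr 3
  apply CommRingCat.hom_ext
  simp only [CommRingCat.hom_comp, CommRingCat.hom_ofHom]
  refine RingHom.ext fun c => ?_
  exact restrict_symm_eq_overlapRingHom halg U' U e ε₁ hε₁ j l c

include hb' hε₂ hψε in
/-- **Normal form of `t j l ≫ (Spec (A ⊗_k Γ(U l)) ≅ U' l ↪ Y)`**: the same `W.toSpecΓ ≫ Spec (Λ_{jl} ∘ ε₁⁻¹) ≫ (U'j ∩ U'l ↪ Y)`.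
[cite: Hartshorne2010, Thm. 10.2 (proof), p. 81] [cite: StacksProject, Tag 01JA] -/
theorem transitionMap_comp_trivialisationChart (j l : ι) :
    transitionMap halg A U ψ j l ≫ Spec.map (CommRingCat.ofHom (e l).symm.toAlgHom.toRingHom) ≫ (U' l).2.fromSpec =
      (chartOverlap A U j l : Scheme.{u}).toSpecΓ ≫ Spec.map (CommRingCat.ofHom
        ((overlapRingHom halg A U j l).comp (ε₁ j l).symm.toAlgHom.toRingHom)) ≫
          (isAffineOpen_inf_upstairs U' b' hb' j l).fromSpec := by
  rw [← (U' l).2.map_fromSpec (isAffineOpen_inf_upstairs U' b' hb' j l) (homOfLE inf_le_right).op,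
    ← Spec.map_comp_assoc, transitionMap_eq, Category.assoc, ← Spec.map_comp_assoc]
  congr 3
  apply CommRingCat.hom_ext
  simp only [CommRingCat.hom_comp, CommRingCat.hom_ofHom]
  refine RingHom.ext fun c => ?_
  exact overlapRingHom_transition_symm_eq halg U' U e ε₁ ε₂ hε₂ ψ hψε j l c

/-! ## §2 The comparison morphism `Ψ : Glue_A(ψ) ⟶ Y`, over `Spec A` -/

include hb' hε₁ hε₂ hψε in
/-- **The trivialisation charts glue**: there is a unique `Ψ : X'_A(ψ) ⟶ Y` restricting on every chart to
`Spec (A ⊗_k Γ(U j)) ≅ Spec Γ(Y, U' j) → Y` (★ `glueData_existsUnique_desc`; the compatibility on `W j l` is §1).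
[cite: StacksProject, Tag 01JA] [cite: Hartshorne2010, Thm. 10.2 (proof), p. 81] -/
theorem existsUnique_gluedToDeformation :
    ∃! Ψ : (deformationGlueDatum halg A U b hb ψ 𝔫 h𝔫 hψ hcoc).glueData.glued ⟶ Y.left,
      ∀ j, (deformationGlueDatum halg A U b hb ψ 𝔫 h𝔫 hψ hcoc).glueData.ι j ≫ Ψ =
        Spec.map (CommRingCat.ofHom (e j).symm.toAlgHom.toRingHom) ≫ (U' j).2.fromSpec := by
  refine glueData_existsUnique_desc (deformationGlueDatum halg A U b hb ψ 𝔫 h𝔫 hψ hcoc).glueData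
    (fun j => Spec.map (CommRingCat.ofHom (e j).symm.toAlgHom.toRingHom) ≫ (U' j).2.fromSpec) fun j l => ?_
  rw [OpensGlueDatum.glueData_f, OpensGlueDatum.glueData_f, OpensGlueDatum.glueData_t,
    ← Category.assoc (OpensGlueDatum.tLift _ j l), OpensGlueDatum.tLift_ι]
  change (chartOverlap A U j l).ι ≫ _ = transitionMap halg A U ψ j l ≫ _
  rw [ι_comp_trivialisationChart halg U' b' hb' U e ε₁ hε₁ j l,
    transitionMap_comp_trivialisationChart halg U' b' hb' U e ε₁ ε₂ hε₂ ψ hψε j l]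

include halgA in
/-- **`Ψ` lies over `Spec A`**: `Ψ ≫ (Y → Spec A) = q`, the structure map of the glued deformation (FILE 3) — on the
chart `j` both are `Spec (A → A ⊗_k Γ(U j))` (`e j` is `A`-linear). [cite: StacksProject, Tag 01LH] [cite: Hartshorne2010, Thm. 10.2 (proof), p. 81] -/
theorem gluedToDeformation_comp_hom
    (Ψ : (deformationGlueDatum halg A U b hb ψ 𝔫 h𝔫 hψ hcoc).glueData.glued ⟶ Y.left)
    (hΨ : ∀ j, (deformationGlueDatum halg A U b hb ψ 𝔫 h𝔫 hψ hcoc).glueData.ι j ≫ Ψ =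
      Spec.map (CommRingCat.ofHom (e j).symm.toAlgHom.toRingHom) ≫ (U' j).2.fromSpec)
    (q : (deformationGlueDatum halg A U b hb ψ 𝔫 h𝔫 hψ hcoc).glueData.glued ⟶ Spec (CommRingCat.of A))
    (hq : ∀ j, (deformationGlueDatum halg A U b hb ψ 𝔫 h𝔫 hψ hcoc).glueData.ι j ≫ q =
      Spec.map (CommRingCat.ofHom (Algebra.TensorProduct.includeLeftRingHom
        (R := k) (A := A) (B := Γ(X.left, (U j).1))))) :
    Ψ ≫ Y.hom = q := by
  refine glueData_hom_ext _ _ _ fun j => ?_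
  rw [← Category.assoc, hΨ j, hq j, Category.assoc, fromSpec_comp_hom_eq_SpecMap_algebraMap halgA (U' j).2,
    ← Spec.map_comp, ← CommRingCat.ofHom_comp]
  congr 2
  refine RingHom.ext fun a => ?_
  change (e j).symm (algebraMap A Γ(Y.left, (U' j).1) a) = a ⊗ₜ 1
  rw [AlgEquiv.commutes, Algebra.TensorProduct.algebraMap_apply, Algebra.algebraMap_self, RingHom.id_apply]

end GluedIso

end Literature.AlgebraicGeometry.Deformation

end
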